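import Mathlib
import HarnessLib.Audit
import Summits.PneNP.PneNP.Theorems.PstarCycleCoreKills

/-!
# The member kills on a general core, from the list of its even subfamilies (ROUND-24, O1; memo g28 §78b)

FRONTIER range-avoidance ladder, rung F-N3, ROUND 24 (cell `pnp-ideate`, prover-2 memo `g28/O1-JOINS-g28.md` §78b; census node
`PstarLocalGateBudgetAssembly.LocalMenuCriterionBoundGateBudget`; restricted-model proof complexity — nothing here bears on `P` versus `NP`).

`PstarCycleCoreKills` instantiates the member kills on CIRCUIT cores (only even subfamilies `∅`, `K`).  The census also meets THETA cores (`K₄ − e`: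
two XOR vertices of degree three), where p3's transparency census located every admissible release (memo r24 §14.70: the `K₄ − e` completions).
By `PstarCircuitJoins.forall_join_of_evens` the joins of ANY core are `(E, 0)` and `(P ∆ E, 1)` for `E` running over the even subfamilies and `P`
one join with the reader.  This file states the kills in that generality, for a finite list `L ⊇ {even subfamilies of K}` supplied by the census
(for `K₄ − e`: `∅` and the three cycles; for a cycle: `∅, K`), typed pure instance, reader linear part of XOR-type variables, privacy on `K ∪ G₁`,
simple overlaps among the monomials of `Γ₂`:

* **`false_of_dirty_member_evens`** — DIRTY member `e ∈ K`.  (idle) ONE clause, shape-independent: if `({e}, 1)` is a join and there are no folds,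
  its value is `0` (the even candidates inside `{e}` and the empty reader are discharged as in the cycle case); (partners) every `Γ₂`-gate partner
  `u` of `p, p'` EITHER carries a one-block value-`1` join inside `K ∖ e` (raw form: the census names it from its join list) OR has a thaw pattern
  `Z ∋ v` of AND-type variables containing its `K ∪ G₁`-partners with, for every `E ∈ L`: `E` all dead ⇒ `v(E,0) ≠ 1`, and `(P ∆ E) ∪ G₁` all dead
  ⇒ `v(P ∆ E,1) ≠ 1`.  Conclusion: (T3) with (M0) at `e` is contradictory; `not_terminal(NC)_of_dirty_member_evens`;
* **`false_of_shared_member_evens`** — member `e = (σ, p)` with sibling `o = (σ, q)`: idle clause in raw join form (candidates inside `{e, o}`),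
  partners as above with `Z ∋ σ`; `not_terminal(NC)_of_shared_member_evens`;
* **`block_join_cases_of_evens`** — the pinning table likewise: a one-block value-`1` join through `s` is `(E,0)` with `E ⊆ Through(s)` or
  `(P ∆ E, 1)` with `(P ∆ E) ∪ G₁ ⊆ Through(s)`, for some `E ∈ L`.
-/

set_option linter.dupNamespace false -- `Summit.PneNP.PneNP.…`: summit = sub-problem name (D-0017 single-conjunct layout)

open Finset Literature.Computability.Complexity
open Summit.PneNP.PneNP.Theorems.PstarFibrePolys (bit)
open Summit.PneNP.PneNP.Theorems.PstarTyped (Typed)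
open Summit.PneNP.PneNP.Theorems.PstarSALevel (varSet)
open Summit.PneNP.PneNP.Theorems.PstarCoreBoundTargets (Terminal)
open Summit.PneNP.PneNP.Theorems.PstarUnion (SatPair)
open Summit.PneNP.PneNP.Theorems.PstarUnionCovers (TerminalNC)
open Summit.PneNP.PneNP.Theorems.PstarChordBridgeTools (xpdeg)
open Summit.PneNP.PneNP.Theorems.PstarLiteralPinning (Through InSlice IsJoin joinValue)
open Summit.PneNP.PneNP.Theorems.PstarDeadPatterns (Dead)
open Summit.PneNP.PneNP.Theorems.PstarSharedMemberSquare (Setup)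
open Summit.PneNP.PneNP.Theorems.PstarCircuitJoins (isJoin_false_iff forall_join_of_evens joinValue_empty)
open Summit.PneNP.PneNP.Theorems.PstarMemberKillCores (false_of_dirty_member_joins false_of_shared_member_joins)
open Summit.PneNP.PneNP.Theorems.PstarCycleCoreKills (through_ne_xor through_not_mem not_even_singleton linear_eq_empty_of_isJoin_empty
  target_false_of_empty_reader)

namespace Summit.PneNP.PneNP.Theorems.PstarCoreKillsEvens

variable {n m : ℕ} {I : LocalMap 4 n m} {y : Fin m → Bool} {K P : Finset (Fin m)} {w₁ w₂ : Finset (Fin n) × Finset (Fin m) × Bool}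
  {L : Finset (Finset (Fin m))}

/-- Every slot variable of an output lies in its variable set. -/
private theorem vars_mem_varSet (I : LocalMap 4 n m) (j : Fin m) (s : Fin 4) : I.vars j s ∈ varSet I j := by
  unfold PstarSALevel.varSet; exact mem_image_of_mem _ (mem_univ s)

/-! ## The pinning table from the even list -/

/-- **ONE-BLOCK JOINS FROM THE EVEN LIST.**  If `L` contains every even subfamily of `K` and `P` is a join with the reader, a one-block value-`1`
join through `s` is `(E, 0)` with `E ⊆ Through(s)`, `v(E,0) = 1`, or `(P ∆ E, 1)` with `(P ∆ E) ∪ G₁ ⊆ Through(s)`, `v(P ∆ E, 1) = 1`, for some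
`E ∈ L` (combine with `PstarLiteralPinningCriterion.constant_iff_block_join`). -/
theorem block_join_cases_of_evens (hL : ∀ E ⊆ K, (∀ w, Even (xpdeg I E w)) → E ∈ L) (hP : P ⊆ K) (hPJ : IsJoin I w₁.1 P true) {s : Fin n}
    (h : ∃ D ⊆ K, ∃ t : Bool, IsJoin I w₁.1 D t ∧ (∀ j ∈ D, Through I s j) ∧ (t = true → ∀ g ∈ w₁.2.1, Through I s g) ∧
      joinValue y w₁.2.2 D t = 1) :
    ∃ E ∈ L, ((∀ j ∈ E, Through I s j) ∧ joinValue y w₁.2.2 E false = 1) ∨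
      ((∀ j ∈ (P \ E) ∪ (E \ P), Through I s j) ∧ (∀ g ∈ w₁.2.1, Through I s g) ∧ joinValue y w₁.2.2 ((P \ E) ∪ (E \ P)) true = 1) := by
  by_contra hno
  push Not at hno
  obtain ⟨D, hD, t, hJ, hDs, hGs, hval⟩ := h
  have key := forall_join_of_evens I L hL hP hPJ
    (fun D t => (∀ j ∈ D, Through I s j) → (t = true → ∀ g ∈ w₁.2.1, Through I s g) → joinValue y w₁.2.2 D t ≠ 1)
    (fun E hE hall _ => (hno E hE).1 hall) (fun E hE hall hfolds => (hno E hE).2 hall (hfolds rfl))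
  exact key D hD t hJ hDs hGs hval

/-! ## The dirty member -/

section Dirty

variable {e : Fin m} {p p' : Fin n}

/-- **THE DIRTY-MEMBER CHECK-LIST ON A GENERAL CORE** (even list `L`).  See the module docstring. -/
theorem false_of_dirty_member_evens (hI : I.IsPure xorAndPred) (hT : Typed I) (hKG : Disjoint K w₁.2.1)
    (hL : ∀ E ⊆ K, (∀ w, Even (xpdeg I E w)) → E ∈ L) (hP : P ⊆ K) (hPJ : IsJoin I w₁.1 P true) (he : e ∈ K)
    (hslots : I.vars e 2 = p ∧ I.vars e 3 = p') (hpe : I.vars e 0 ≠ p ∧ I.vars e 1 ≠ p ∧ I.vars e 0 ≠ p' ∧ I.vars e 1 ≠ p')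
    (hpK : ∀ j ∈ K, j ≠ e → p ∉ varSet I j ∧ p' ∉ varSet I j)
    (hpG₁ : ∀ g ∈ w₁.2.1, (I.vars g 2 ≠ p ∧ I.vars g 3 ≠ p) ∧ (I.vars g 2 ≠ p' ∧ I.vars g 3 ≠ p'))
    (hpp' : ∀ g ∈ w₂.2.1, ¬ ((I.vars g 2 = p ∧ I.vars g 3 = p') ∨ (I.vars g 2 = p' ∧ I.vars g 3 = p)))
    (hSG : ∀ g ∈ w₂.2.1, ∀ g' ∈ w₂.2.1, g' ≠ g → ¬ ((I.vars g' 2 = I.vars g 2 ∧ I.vars g' 3 = I.vars g 3) ∨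
      (I.vars g' 2 = I.vars g 3 ∧ I.vars g' 3 = I.vars g 2)))
    (hC₁X : ∀ v ∈ w₁.1, ∃ j : Fin m, ∃ s : Fin 4, s.val < 2 ∧ I.vars j s = v)
    (hpriv : ∀ j ∈ K ∪ w₁.2.1, ∃ a, Through I a j ∧ ∀ j' ∈ K ∪ w₁.2.1, Through I a j' → j' = j)
    (hidle : IsJoin I w₁.1 {e} true → w₁.2.1 = ∅ → joinValue y w₁.2.2 {e} true ≠ 1)
    (hpart : ∀ g ∈ w₂.2.1, ∀ u v : Fin n, (v = p ∨ v = p') → ((I.vars g 2 = v ∧ I.vars g 3 = u) ∨ (I.vars g 2 = u ∧ I.vars g 3 = v)) →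
      (∃ D ⊆ K.erase e, ∃ t : Bool, IsJoin I w₁.1 D t ∧ (∀ j ∈ D, Through I u j) ∧ (t = true → ∀ g' ∈ w₁.2.1, Through I u g') ∧
          joinValue y w₁.2.2 D t = 1) ∨
      ∃ Z : Finset (Fin n), v ∈ Z ∧ (∀ w ∈ Z, ∃ j : Fin m, Through I w j) ∧
        (∀ j ∈ K ∪ w₁.2.1, (I.vars j 2 = u → I.vars j 3 ∈ Z) ∧ (I.vars j 3 = u → I.vars j 2 ∈ Z)) ∧
        (∀ E ∈ L, (∀ j ∈ E, Dead I Z j) → joinValue y w₁.2.2 E false ≠ 1) ∧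
        (∀ E ∈ L, (∀ j ∈ (P \ E) ∪ (E \ P), Dead I Z j) → (∀ g' ∈ w₁.2.1, Dead I Z g') →
          joinValue y w₁.2.2 ((P \ E) ∪ (E \ P)) true ≠ 1))
    (hT3 : ¬ SatPair I y K w₁ w₂) (hM0 : SatPair I y (K.erase e) w₁ w₂) : False := by
  have hep : Through I p e := Or.inl hslots.1
  have hC₁ : ∀ v ∈ w₁.1, ∀ j ∈ K ∪ w₁.2.1, ¬ Through I v j := fun v hv j _ hth => through_not_mem hT hC₁X hth hv
  have hpC₁ : p ∉ w₁.1 ∧ p' ∉ w₁.1 := ⟨through_not_mem hT hC₁X hep, through_not_mem hT hC₁X (Or.inr hslots.2 : Through I p' e)⟩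
  have hponly : ∀ j ∈ K, Through I p j → j = e := by
    intro j hj hth
    by_contra hje
    rcases hth with h | h
    · exact (hpK j hj hje).1 (h ▸ vars_mem_varSet I j 2)
    · exact (hpK j hj hje).1 (h ▸ vars_mem_varSet I j 3)
  have hpfold : ∀ g ∈ w₁.2.1, ¬ Through I p g := fun g hg hth => by
    rcases hth with h | h
    · exact (hpG₁ g hg).1.1 h
    · exact (hpG₁ g hg).1.2 h
  -- the idle pattern `{p}`: every candidate lies inside `{e}`
  have hidle' : ∀ D ⊆ K, ∀ t : Bool, IsJoin I w₁.1 D t → (∀ j ∈ D, Through I p j) → (t = true → ∀ g ∈ w₁.2.1, Through I p g) →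
      joinValue y w₁.2.2 D t ≠ 1 := by
    intro D hD t hJ hall hfolds
    have hDe : D ⊆ {e} := fun j hj => mem_singleton.2 (hponly j (hD hj) (hall j hj))
    cases t
    · rcases subset_singleton_iff.1 hDe with rfl | rfl
      · rw [joinValue_empty]; exact zero_ne_one
      · exact absurd ((isJoin_false_iff I _ _).1 hJ) (not_even_singleton hI e)
    · have hG : w₁.2.1 = ∅ := eq_empty_of_forall_notMem fun g hg => hpfold g hg (hfolds rfl g hg)
      rcases subset_singleton_iff.1 hDe with rfl | rfl
      · have hC : w₁.1 = ∅ := linear_eq_empty_of_isJoin_empty hJ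
        obtain ⟨q, -, hq₁, -⟩ := hM0
        have hb : w₁.2.2 = false := target_false_of_empty_reader hC hG hq₁
        simp [joinValue, hb, bit]
      · exact hidle hJ hG
  -- the partners
  have hpart' : ∀ g ∈ w₂.2.1, ∀ u v : Fin n, (v = p ∨ v = p') →
      ((I.vars g 2 = v ∧ I.vars g 3 = u) ∨ (I.vars g 2 = u ∧ I.vars g 3 = v)) →
      (∃ D ⊆ K.erase e, ∃ t : Bool, IsJoin I w₁.1 D t ∧ (∀ j ∈ D, Through I u j) ∧ (t = true → ∀ g' ∈ w₁.2.1, Through I u g') ∧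
          joinValue y w₁.2.2 D t = 1) ∨
      (u ∉ w₁.1 ∧ (∀ j ∈ K, I.vars j 0 ≠ u ∧ I.vars j 1 ≠ u) ∧
        ∃ Z : Finset (Fin n), v ∈ Z ∧ (∀ j ∈ K ∪ w₁.2.1, (I.vars j 2 = u → I.vars j 3 ∈ Z) ∧ (I.vars j 3 = u → I.vars j 2 ∈ Z)) ∧
          (∀ w ∈ Z, ∀ j ∈ K, I.vars j 0 ≠ w ∧ I.vars j 1 ≠ w) ∧ (∀ w ∈ Z, w ∉ w₁.1) ∧
          ∀ D ⊆ K, ∀ t : Bool, IsJoin I w₁.1 D t → (∀ j ∈ D, Dead I Z j) → (t = true → ∀ g' ∈ w₁.2.1, Dead I Z g') →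
            joinValue y w₁.2.2 D t ≠ 1) := by
    intro g hg u v hv hgs
    have hug : Through I u g := by
      rcases hgs with ⟨_, h3⟩ | ⟨h2, _⟩
      · exact Or.inr h3
      · exact Or.inl h2
    rcases hpart g hg u v hv hgs with hpin | ⟨Z, hvZ, hZand, huZ, h0, h1⟩
    · exact Or.inl hpin
    · refine Or.inr ⟨through_not_mem hT hC₁X hug, fun j _ => through_ne_xor hT hug j, Z, hvZ, huZ,
        fun w hw j _ => ?_, fun w hw => ?_, ?_⟩
      · obtain ⟨j', hj'⟩ := hZand w hw; exact through_ne_xor hT hj' j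
      · obtain ⟨j', hj'⟩ := hZand w hw; exact through_not_mem hT hC₁X hj'
      · exact forall_join_of_evens I L hL hP hPJ
          (fun D t => (∀ j ∈ D, Dead I Z j) → (t = true → ∀ g' ∈ w₁.2.1, Dead I Z g') → joinValue y w₁.2.2 D t ≠ 1)
          (fun E hE hall _ => h0 E hE hall) (fun E hE hall hfolds => h1 E hE hall (hfolds rfl))
  exact false_of_dirty_member_joins hI hT he hKG hslots hpe hpK hpC₁ hpG₁ hpp' hSG hC₁ hpriv hidle' hpart' hT3 hM0

/-- **The dirty-member check-list (even list) kills a terminal core.** -/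
theorem not_terminal_of_dirty_member_evens {r : ℕ} (hI : I.IsPure xorAndPred) (hT : Typed I)
    (hL : ∀ E ⊆ K, (∀ w, Even (xpdeg I E w)) → E ∈ L) (hP : P ⊆ K) (hPJ : IsJoin I w₁.1 P true) (he : e ∈ K)
    (hslots : I.vars e 2 = p ∧ I.vars e 3 = p') (hpe : I.vars e 0 ≠ p ∧ I.vars e 1 ≠ p ∧ I.vars e 0 ≠ p' ∧ I.vars e 1 ≠ p')
    (hpK : ∀ j ∈ K, j ≠ e → p ∉ varSet I j ∧ p' ∉ varSet I j)
    (hpG₁ : ∀ g ∈ w₁.2.1, (I.vars g 2 ≠ p ∧ I.vars g 3 ≠ p) ∧ (I.vars g 2 ≠ p' ∧ I.vars g 3 ≠ p'))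
    (hpp' : ∀ g ∈ w₂.2.1, ¬ ((I.vars g 2 = p ∧ I.vars g 3 = p') ∨ (I.vars g 2 = p' ∧ I.vars g 3 = p)))
    (hSG : ∀ g ∈ w₂.2.1, ∀ g' ∈ w₂.2.1, g' ≠ g → ¬ ((I.vars g' 2 = I.vars g 2 ∧ I.vars g' 3 = I.vars g 3) ∨
      (I.vars g' 2 = I.vars g 3 ∧ I.vars g' 3 = I.vars g 2)))
    (hC₁X : ∀ v ∈ w₁.1, ∃ j : Fin m, ∃ s : Fin 4, s.val < 2 ∧ I.vars j s = v)
    (hpriv : ∀ j ∈ K ∪ w₁.2.1, ∃ a, Through I a j ∧ ∀ j' ∈ K ∪ w₁.2.1, Through I a j' → j' = j)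
    (hidle : IsJoin I w₁.1 {e} true → w₁.2.1 = ∅ → joinValue y w₁.2.2 {e} true ≠ 1)
    (hpart : ∀ g ∈ w₂.2.1, ∀ u v : Fin n, (v = p ∨ v = p') → ((I.vars g 2 = v ∧ I.vars g 3 = u) ∨ (I.vars g 2 = u ∧ I.vars g 3 = v)) →
      (∃ D ⊆ K.erase e, ∃ t : Bool, IsJoin I w₁.1 D t ∧ (∀ j ∈ D, Through I u j) ∧ (t = true → ∀ g' ∈ w₁.2.1, Through I u g') ∧
          joinValue y w₁.2.2 D t = 1) ∨
      ∃ Z : Finset (Fin n), v ∈ Z ∧ (∀ w ∈ Z, ∃ j : Fin m, Through I w j) ∧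
        (∀ j ∈ K ∪ w₁.2.1, (I.vars j 2 = u → I.vars j 3 ∈ Z) ∧ (I.vars j 3 = u → I.vars j 2 ∈ Z)) ∧
        (∀ E ∈ L, (∀ j ∈ E, Dead I Z j) → joinValue y w₁.2.2 E false ≠ 1) ∧
        (∀ E ∈ L, (∀ j ∈ (P \ E) ∪ (E \ P), Dead I Z j) → (∀ g' ∈ w₁.2.1, Dead I Z g') →
          joinValue y w₁.2.2 ((P \ E) ∪ (E \ P)) true ≠ 1)) :
    ¬ Terminal I r y K w₁ w₂ := fun ht =>
  false_of_dirty_member_evens hI hT ht.2.2.2.1 hL hP hPJ he hslots hpe hpK hpG₁ hpp' hSG hC₁X hpriv hidle hpart ht.2.2.2.2.2.2.1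
    (ht.2.2.2.2.2.2.2 e he)

/-- **The dirty-member check-list (even list) kills a minimal core (`TerminalNC`).** -/
theorem not_terminalNC_of_dirty_member_evens {r : ℕ} (hI : I.IsPure xorAndPred) (hT : Typed I)
    (hL : ∀ E ⊆ K, (∀ w, Even (xpdeg I E w)) → E ∈ L) (hP : P ⊆ K) (hPJ : IsJoin I w₁.1 P true) (he : e ∈ K)
    (hslots : I.vars e 2 = p ∧ I.vars e 3 = p') (hpe : I.vars e 0 ≠ p ∧ I.vars e 1 ≠ p ∧ I.vars e 0 ≠ p' ∧ I.vars e 1 ≠ p')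
    (hpK : ∀ j ∈ K, j ≠ e → p ∉ varSet I j ∧ p' ∉ varSet I j)
    (hpG₁ : ∀ g ∈ w₁.2.1, (I.vars g 2 ≠ p ∧ I.vars g 3 ≠ p) ∧ (I.vars g 2 ≠ p' ∧ I.vars g 3 ≠ p'))
    (hpp' : ∀ g ∈ w₂.2.1, ¬ ((I.vars g 2 = p ∧ I.vars g 3 = p') ∨ (I.vars g 2 = p' ∧ I.vars g 3 = p)))
    (hSG : ∀ g ∈ w₂.2.1, ∀ g' ∈ w₂.2.1, g' ≠ g → ¬ ((I.vars g' 2 = I.vars g 2 ∧ I.vars g' 3 = I.vars g 3) ∨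
      (I.vars g' 2 = I.vars g 3 ∧ I.vars g' 3 = I.vars g 2)))
    (hC₁X : ∀ v ∈ w₁.1, ∃ j : Fin m, ∃ s : Fin 4, s.val < 2 ∧ I.vars j s = v)
    (hpriv : ∀ j ∈ K ∪ w₁.2.1, ∃ a, Through I a j ∧ ∀ j' ∈ K ∪ w₁.2.1, Through I a j' → j' = j)
    (hidle : IsJoin I w₁.1 {e} true → w₁.2.1 = ∅ → joinValue y w₁.2.2 {e} true ≠ 1)
    (hpart : ∀ g ∈ w₂.2.1, ∀ u v : Fin n, (v = p ∨ v = p') → ((I.vars g 2 = v ∧ I.vars g 3 = u) ∨ (I.vars g 2 = u ∧ I.vars g 3 = v)) →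
      (∃ D ⊆ K.erase e, ∃ t : Bool, IsJoin I w₁.1 D t ∧ (∀ j ∈ D, Through I u j) ∧ (t = true → ∀ g' ∈ w₁.2.1, Through I u g') ∧
          joinValue y w₁.2.2 D t = 1) ∨
      ∃ Z : Finset (Fin n), v ∈ Z ∧ (∀ w ∈ Z, ∃ j : Fin m, Through I w j) ∧
        (∀ j ∈ K ∪ w₁.2.1, (I.vars j 2 = u → I.vars j 3 ∈ Z) ∧ (I.vars j 3 = u → I.vars j 2 ∈ Z)) ∧
        (∀ E ∈ L, (∀ j ∈ E, Dead I Z j) → joinValue y w₁.2.2 E false ≠ 1) ∧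
        (∀ E ∈ L, (∀ j ∈ (P \ E) ∪ (E \ P), Dead I Z j) → (∀ g' ∈ w₁.2.1, Dead I Z g') →
          joinValue y w₁.2.2 ((P \ E) ∪ (E \ P)) true ≠ 1)) :
    ¬ TerminalNC I r y K w₁ w₂ := fun ht =>
  false_of_dirty_member_evens hI hT ht.2.2.1 hL hP hPJ he hslots hpe hpK hpG₁ hpp' hSG hC₁X hpriv hidle hpart ht.2.2.2.2.2.1
    (ht.2.2.2.2.2.2 e he)

end Dirty

/-! ## The shared-literal member -/

section Shared

variable {e o : Fin m} {σ p q : Fin n}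

/-- **THE SHARED-LITERAL CHECK-LIST ON A GENERAL CORE** (even list `L`): idle candidates in raw join form (they lie inside `{e, o}`), partners via
the even list.  Conclusion: (T3) with (M0) at `e` is contradictory. -/
theorem false_of_shared_member_evens (H : Setup I K w₁ w₂ e o σ p q) (hT : Typed I)
    (hL : ∀ E ⊆ K, (∀ w, Even (xpdeg I E w)) → E ∈ L) (hP : P ⊆ K) (hPJ : IsJoin I w₁.1 P true)
    (hSG : ∀ g ∈ w₂.2.1, ∀ g' ∈ w₂.2.1, g' ≠ g → ¬ ((I.vars g' 2 = I.vars g 2 ∧ I.vars g' 3 = I.vars g 3) ∨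
      (I.vars g' 2 = I.vars g 3 ∧ I.vars g' 3 = I.vars g 2)))
    (hC₁X : ∀ v ∈ w₁.1, ∃ j : Fin m, ∃ s : Fin 4, s.val < 2 ∧ I.vars j s = v)
    (hpriv : ∀ j ∈ K ∪ w₁.2.1, ∃ a, Through I a j ∧ ∀ j' ∈ K ∪ w₁.2.1, Through I a j' → j' = j)
    (hidle : ∀ D ⊆ K, ∀ t : Bool, IsJoin I w₁.1 D t → (∀ j ∈ D, Through I σ j) → (t = true → ∀ g ∈ w₁.2.1, Through I σ g) →
      joinValue y w₁.2.2 D t ≠ 1)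
    (hpart : ∀ g ∈ w₂.2.1, ∀ u v : Fin n, (v = p ∨ v = q ∨ v = σ) → ((I.vars g 2 = v ∧ I.vars g 3 = u) ∨ (I.vars g 2 = u ∧ I.vars g 3 = v)) →
      u ≠ p → u ≠ q → u ≠ σ →
      (∃ D ⊆ K.erase e, ∃ t : Bool, IsJoin I w₁.1 D t ∧ (∀ j ∈ D, Through I u j) ∧ (t = true → ∀ g' ∈ w₁.2.1, Through I u g') ∧
          joinValue y w₁.2.2 D t = 1) ∨
      ∃ Z : Finset (Fin n), σ ∈ Z ∧ (∀ w ∈ Z, ∃ j : Fin m, Through I w j) ∧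
        (∀ j ∈ K ∪ w₁.2.1, (I.vars j 2 = u → I.vars j 3 ∈ Z) ∧ (I.vars j 3 = u → I.vars j 2 ∈ Z)) ∧
        (∀ E ∈ L, (∀ j ∈ E, Dead I Z j) → joinValue y w₁.2.2 E false ≠ 1) ∧
        (∀ E ∈ L, (∀ j ∈ (P \ E) ∪ (E \ P), Dead I Z j) → (∀ g' ∈ w₁.2.1, Dead I Z g') →
          joinValue y w₁.2.2 ((P \ E) ∪ (E \ P)) true ≠ 1))
    (hT3 : ¬ SatPair I y K w₁ w₂) (hM0 : SatPair I y (K.erase e) w₁ w₂) : False := by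
  have hC₁ : ∀ v ∈ w₁.1, ∀ j ∈ K ∪ w₁.2.1, ¬ Through I v j := fun v hv j _ hth => through_not_mem hT hC₁X hth hv
  have hpart' : ∀ g ∈ w₂.2.1, ∀ u v : Fin n, (v = p ∨ v = q ∨ v = σ) →
      ((I.vars g 2 = v ∧ I.vars g 3 = u) ∨ (I.vars g 2 = u ∧ I.vars g 3 = v)) → u ≠ p → u ≠ q → u ≠ σ →
      (∃ D ⊆ K.erase e, ∃ t : Bool, IsJoin I w₁.1 D t ∧ (∀ j ∈ D, Through I u j) ∧ (t = true → ∀ g' ∈ w₁.2.1, Through I u g') ∧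
          joinValue y w₁.2.2 D t = 1) ∨
      (u ∉ w₁.1 ∧ (∀ j ∈ K, I.vars j 0 ≠ u ∧ I.vars j 1 ≠ u) ∧
        ∃ Z : Finset (Fin n), σ ∈ Z ∧ (∀ j ∈ K ∪ w₁.2.1, (I.vars j 2 = u → I.vars j 3 ∈ Z) ∧ (I.vars j 3 = u → I.vars j 2 ∈ Z)) ∧
          (∀ w ∈ Z, ∀ j ∈ K, I.vars j 0 ≠ w ∧ I.vars j 1 ≠ w) ∧ (∀ w ∈ Z, w ∉ w₁.1) ∧
          ∀ D ⊆ K, ∀ t : Bool, IsJoin I w₁.1 D t → (∀ j ∈ D, Dead I Z j) → (t = true → ∀ g' ∈ w₁.2.1, Dead I Z g') →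
            joinValue y w₁.2.2 D t ≠ 1) := by
    intro g hg u v hv hgs hup huq huσ
    have hug : Through I u g := by
      rcases hgs with ⟨_, h3⟩ | ⟨h2, _⟩
      · exact Or.inr h3
      · exact Or.inl h2
    rcases hpart g hg u v hv hgs hup huq huσ with hpin | ⟨Z, hσZ, hZand, huZ, h0, h1⟩
    · exact Or.inl hpin
    · refine Or.inr ⟨through_not_mem hT hC₁X hug, fun j _ => through_ne_xor hT hug j, Z, hσZ, huZ,
        fun w hw j _ => ?_, fun w hw => ?_, ?_⟩
      · obtain ⟨j', hj'⟩ := hZand w hw; exact through_ne_xor hT hj' j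
      · obtain ⟨j', hj'⟩ := hZand w hw; exact through_not_mem hT hC₁X hj'
      · exact forall_join_of_evens I L hL hP hPJ
          (fun D t => (∀ j ∈ D, Dead I Z j) → (t = true → ∀ g' ∈ w₁.2.1, Dead I Z g') → joinValue y w₁.2.2 D t ≠ 1)
          (fun E hE hall _ => h0 E hE hall) (fun E hE hall hfolds => h1 E hE hall (hfolds rfl))
  exact false_of_shared_member_joins H hT hSG hC₁ hpriv hidle hpart' hT3 hM0

/-- **The shared-literal check-list (even list) kills a terminal core.** -/
theorem not_terminal_of_shared_member_evens {r : ℕ} (H : Setup I K w₁ w₂ e o σ p q) (hT : Typed I)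
    (hL : ∀ E ⊆ K, (∀ w, Even (xpdeg I E w)) → E ∈ L) (hP : P ⊆ K) (hPJ : IsJoin I w₁.1 P true)
    (hSG : ∀ g ∈ w₂.2.1, ∀ g' ∈ w₂.2.1, g' ≠ g → ¬ ((I.vars g' 2 = I.vars g 2 ∧ I.vars g' 3 = I.vars g 3) ∨
      (I.vars g' 2 = I.vars g 3 ∧ I.vars g' 3 = I.vars g 2)))
    (hC₁X : ∀ v ∈ w₁.1, ∃ j : Fin m, ∃ s : Fin 4, s.val < 2 ∧ I.vars j s = v)
    (hpriv : ∀ j ∈ K ∪ w₁.2.1, ∃ a, Through I a j ∧ ∀ j' ∈ K ∪ w₁.2.1, Through I a j' → j' = j)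
    (hidle : ∀ D ⊆ K, ∀ t : Bool, IsJoin I w₁.1 D t → (∀ j ∈ D, Through I σ j) → (t = true → ∀ g ∈ w₁.2.1, Through I σ g) →
      joinValue y w₁.2.2 D t ≠ 1)
    (hpart : ∀ g ∈ w₂.2.1, ∀ u v : Fin n, (v = p ∨ v = q ∨ v = σ) → ((I.vars g 2 = v ∧ I.vars g 3 = u) ∨ (I.vars g 2 = u ∧ I.vars g 3 = v)) →
      u ≠ p → u ≠ q → u ≠ σ →
      (∃ D ⊆ K.erase e, ∃ t : Bool, IsJoin I w₁.1 D t ∧ (∀ j ∈ D, Through I u j) ∧ (t = true → ∀ g' ∈ w₁.2.1, Through I u g') ∧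
          joinValue y w₁.2.2 D t = 1) ∨
      ∃ Z : Finset (Fin n), σ ∈ Z ∧ (∀ w ∈ Z, ∃ j : Fin m, Through I w j) ∧
        (∀ j ∈ K ∪ w₁.2.1, (I.vars j 2 = u → I.vars j 3 ∈ Z) ∧ (I.vars j 3 = u → I.vars j 2 ∈ Z)) ∧
        (∀ E ∈ L, (∀ j ∈ E, Dead I Z j) → joinValue y w₁.2.2 E false ≠ 1) ∧
        (∀ E ∈ L, (∀ j ∈ (P \ E) ∪ (E \ P), Dead I Z j) → (∀ g' ∈ w₁.2.1, Dead I Z g') →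
          joinValue y w₁.2.2 ((P \ E) ∪ (E \ P)) true ≠ 1)) :
    ¬ Terminal I r y K w₁ w₂ := fun ht =>
  false_of_shared_member_evens H hT hL hP hPJ hSG hC₁X hpriv hidle hpart ht.2.2.2.2.2.2.1 (ht.2.2.2.2.2.2.2 e H.he)

/-- **The shared-literal check-list (even list) kills a minimal core (`TerminalNC`).** -/
theorem not_terminalNC_of_shared_member_evens {r : ℕ} (H : Setup I K w₁ w₂ e o σ p q) (hT : Typed I)
    (hL : ∀ E ⊆ K, (∀ w, Even (xpdeg I E w)) → E ∈ L) (hP : P ⊆ K) (hPJ : IsJoin I w₁.1 P true)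
    (hSG : ∀ g ∈ w₂.2.1, ∀ g' ∈ w₂.2.1, g' ≠ g → ¬ ((I.vars g' 2 = I.vars g 2 ∧ I.vars g' 3 = I.vars g 3) ∨
      (I.vars g' 2 = I.vars g 3 ∧ I.vars g' 3 = I.vars g 2)))
    (hC₁X : ∀ v ∈ w₁.1, ∃ j : Fin m, ∃ s : Fin 4, s.val < 2 ∧ I.vars j s = v)
    (hpriv : ∀ j ∈ K ∪ w₁.2.1, ∃ a, Through I a j ∧ ∀ j' ∈ K ∪ w₁.2.1, Through I a j' → j' = j)
    (hidle : ∀ D ⊆ K, ∀ t : Bool, IsJoin I w₁.1 D t → (∀ j ∈ D, Through I σ j) → (t = true → ∀ g ∈ w₁.2.1, Through I σ g) →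
      joinValue y w₁.2.2 D t ≠ 1)
    (hpart : ∀ g ∈ w₂.2.1, ∀ u v : Fin n, (v = p ∨ v = q ∨ v = σ) → ((I.vars g 2 = v ∧ I.vars g 3 = u) ∨ (I.vars g 2 = u ∧ I.vars g 3 = v)) →
      u ≠ p → u ≠ q → u ≠ σ →
      (∃ D ⊆ K.erase e, ∃ t : Bool, IsJoin I w₁.1 D t ∧ (∀ j ∈ D, Through I u j) ∧ (t = true → ∀ g' ∈ w₁.2.1, Through I u g') ∧
          joinValue y w₁.2.2 D t = 1) ∨
      ∃ Z : Finset (Fin n), σ ∈ Z ∧ (∀ w ∈ Z, ∃ j : Fin m, Through I w j) ∧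
        (∀ j ∈ K ∪ w₁.2.1, (I.vars j 2 = u → I.vars j 3 ∈ Z) ∧ (I.vars j 3 = u → I.vars j 2 ∈ Z)) ∧
        (∀ E ∈ L, (∀ j ∈ E, Dead I Z j) → joinValue y w₁.2.2 E false ≠ 1) ∧
        (∀ E ∈ L, (∀ j ∈ (P \ E) ∪ (E \ P), Dead I Z j) → (∀ g' ∈ w₁.2.1, Dead I Z g') →
          joinValue y w₁.2.2 ((P \ E) ∪ (E \ P)) true ≠ 1)) :
    ¬ TerminalNC I r y K w₁ w₂ := fun ht =>
  false_of_shared_member_evens H hT hL hP hPJ hSG hC₁X hpriv hidle hpart ht.2.2.2.2.2.1 (ht.2.2.2.2.2.2 e H.he)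

end Shared

end Summit.PneNP.PneNP.Theorems.PstarCoreKillsEvens
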